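import Literature.NumberTheory.EllipticCurves.Zhai2016.NonvanishingQuadraticTwists
import Literature.NumberTheory.EllipticCurves.BSDQuadraticDescentPeriodEliminationProofs
import HarnessLib

/-!
# Cell «bsd-uniform», track U2, ROUTE B — `CorC`'s Zhai binder from the TYPED Zhai 2016 theorems

HONEST FRAMING (cell «bsd-uniform», HOME `run/shared/lean/pub/bsd-uniform/`, seat u2-p2). What this
file IS: the adapter between the AS-PRINTED typed conclusions of Zhai 2016 Thms. 1.1/1.2 (tree node
`Zhai2016.NonvanishingQuadraticTwists`: `∃ x, IsLAlg WM x ∧ x ≠ 0 ∧ padicValRat 2 x = 0` for `Δ < 0`,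
`= 1` for `Δ > 0`, where `IsLAlg V x : L(V,1) = x · Ω_∞(V)` with the LEAST real period `Ω_∞`) and the
binder `hZhai` of `CorC.bsdp_two_genusPair_of_bookkeeping` / `RouteBAssembly` (BSD-period currency:
`∃ q, L^{(r)}(A,1)/r! = q · Ω(A) ∧ q ≠ 0 ∧ ord₂ q = 0`, `Ω = c_∞ · Ω_∞ = realPeriodRat`): PROVED that
`q = x / c_∞` works, `ord₂ q = ord₂ x − ord₂ c_∞ = 0 − 0` (`Δ < 0`, `c_∞ = 1`) resp. `1 − 1` (`Δ > 0`,
`c_∞ = 2`) — Zhai's two valuations ARE the statement "`L(A,1)/Ω_A` is a `2`-adic unit" (T4-PROOF I6: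
"his `ord₂ L^{alg} = 0` for `Δ < 0`, `= 1` for `Δ > 0`, with `L^{alg} = L/Ω_∞`, `Ω_X = c_∞Ω_∞`";
Kriz–Li 2019 proof of Lemma 5.3: "notice that the Néron period is twice the real period when `Δ > 0`").
What this file is NOT: Zhai's theorems stay typed binders (`thm11_…`, `thm12_…`, PUBLISHED, nothing
asserted); this file only converts their printed conclusion; nothing booked.

References: Zhai 2016 Thms. 1.1–1.2 [Zhai2016]; Kriz–Li 2019 Lemma 5.3 (proof) [KrizLi2019];
Coates–Li–Tian–Zhai 2015 §1 (1.3) (`c_∞`) [CoatesLiTianZhai2015]; `p2/idea-2/T4-PROOF.md` I6, §7.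
-/

noncomputable section

open scoped Classical

open WeierstrassCurve Literature.NumberTheory.EllipticCurves
  Literature.NumberTheory.EllipticCurves.CoatesLiTianZhai2015
  Literature.NumberTheory.EllipticCurves.Zhai2016

namespace Summit.BirchSwinnertonDyer.Uniform.U2

/-- **Zhai's algebraic `L`-value in BSD-period currency.** If `L(A,1) = x · Ω_∞(A)` (`IsLAlg A x`),
`x ≠ 0`, `r_an(A) = 0` and `ord₂ x = ord₂ c_∞(A)`, then `L^{(0)}(A,1)/0! = q · Ω(A)` with
`q = x / c_∞ ≠ 0` of `2`-adic valuation `0` — the binder `hZhai` of `CorC`.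
[cite: Zhai2016, §1 (arXiv:1409.0231 chunk p0002 L12–L18: L^{alg} = L/Ω_∞)]
[cite: CoatesLiTianZhai2015, §1 (1.3) (the factor c_∞)] -/
theorem exists_leadingLCoeff_eq_unit_mul_realPeriodRat_of_isLAlg (A : WeierstrassCurve ℚ)
    [A.IsElliptic] (hr : A.analyticRank = 0) {x : ℚ} (hx : IsLAlg A x) (hx0 : x ≠ 0)
    (hv : padicValRat 2 x = padicValNat 2 (A.baseChange ℝ).numRealComponents) :
    ∃ q : ℚ, A.leadingLCoeff = (q : ℂ) * (A.realPeriodRat : ℂ) ∧ q ≠ 0 ∧ padicValRat 2 q = 0 := by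
  have hcpos := WeierstrassCurve.numRealComponents_pos (A.baseChange ℝ)
  have hc0 : ((A.baseChange ℝ).numRealComponents : ℚ) ≠ 0 := by exact_mod_cast hcpos.ne'
  refine ⟨x / ((A.baseChange ℝ).numRealComponents : ℚ), ?_, div_ne_zero hx0 hc0, ?_⟩
  · have hcN : ((A.baseChange ℝ).numRealComponents : ℂ) ≠ 0 := by exact_mod_cast hcpos.ne'
    rw [A.leadingLCoeff_eq_of_analyticRank_eq_zero hr, hx,
      realPeriodRat_eq_numRealComponents_mul_leastRealPeriod A]
    push_cast
    field_simp
  · rw [padicValRat.div hx0 hc0, padicValRat.of_nat, hv, sub_self]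

/-- `Δ(A) < 0`: `c_∞ = 1`, so Zhai 2016 Thm. 1.1's `ord₂ x = 0` is the required valuation.
[cite: Zhai2016, Thm. 1.1 (conclusion ord₂ = 0, Δ < 0)] -/
theorem exists_leadingLCoeff_eq_unit_mul_realPeriodRat_of_isLAlg_of_Δ_neg
    (A : WeierstrassCurve ℚ) [A.IsElliptic] (hΔ : A.Δ < 0) (hr : A.analyticRank = 0) {x : ℚ}
    (hx : IsLAlg A x) (hx0 : x ≠ 0) (hv : padicValRat 2 x = 0) :
    ∃ q : ℚ, A.leadingLCoeff = (q : ℂ) * (A.realPeriodRat : ℂ) ∧ q ≠ 0 ∧ padicValRat 2 q = 0 := by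
  refine exists_leadingLCoeff_eq_unit_mul_realPeriodRat_of_isLAlg A hr hx hx0 ?_
  rw [hv, numRealComponents_baseChange_real, if_neg (not_lt.2 hΔ.le)]
  simp

/-- `Δ(A) > 0`: `c_∞ = 2`, so Zhai 2016 Thm. 1.2's `ord₂ x = 1` is the required valuation ("the
Néron period is twice the real period when `Δ > 0`", Kriz–Li proof of Lemma 5.3).
[cite: Zhai2016, Thm. 1.2 (conclusion ord₂ = 1, Δ > 0)] [cite: KrizLi2019, Lemma 5.3 (proof)] -/
theorem exists_leadingLCoeff_eq_unit_mul_realPeriodRat_of_isLAlg_of_Δ_pos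
    (A : WeierstrassCurve ℚ) [A.IsElliptic] (hΔ : 0 < A.Δ) (hr : A.analyticRank = 0) {x : ℚ}
    (hx : IsLAlg A x) (hx0 : x ≠ 0) (hv : padicValRat 2 x = 1) :
    ∃ q : ℚ, A.leadingLCoeff = (q : ℂ) * (A.realPeriodRat : ℂ) ∧ q ≠ 0 ∧ padicValRat 2 q = 0 := by
  refine exists_leadingLCoeff_eq_unit_mul_realPeriodRat_of_isLAlg A hr hx hx0 ?_
  rw [hv, numRealComponents_baseChange_real, if_pos hΔ]
  simp

/-- **From a Zhai-type conclusion package** (`∃ x, IsLAlg A x ∧ x ≠ 0 ∧ ord₂ x = v`, the literal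
output shape of `Zhai2016.thm11_ordTwo_LAlg_twist_eq_zero` (`v = 0`, `Δ < 0`) and
`thm12_ordTwo_LAlg_twist_eq_one` (`v = 1`, `Δ > 0`), together with `L(A,1) ≠ 0`) to `CorC`'s binder,
with `r_an(A) = 0` read off `L(A,1) ≠ 0` under Modularity (`analyticRank_eq_zero_iff_holds`).
[cite: Zhai2016, Thms. 1.1 and 1.2 (conclusions)] -/
theorem exists_leadingLCoeff_eq_unit_mul_realPeriodRat_of_zhai (hE : hasEntireLFunction_rat)
    (A : WeierstrassCurve ℚ) [A.IsElliptic]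
    (hZ : (A.Δ < 0 ∧ ∃ x : ℚ, IsLAlg A x ∧ x ≠ 0 ∧ padicValRat 2 x = 0) ∨
      (0 < A.Δ ∧ ∃ x : ℚ, IsLAlg A x ∧ x ≠ 0 ∧ padicValRat 2 x = 1))
    (hL : A.entireLFunction 1 ≠ 0) :
    ∃ q : ℚ, A.leadingLCoeff = (q : ℂ) * (A.realPeriodRat : ℂ) ∧ q ≠ 0 ∧ padicValRat 2 q = 0 := by
  have hr : A.analyticRank = 0 := (A.analyticRank_eq_zero_iff_holds (hE A)).2 hL
  rcases hZ with ⟨hΔ, x, hx, hx0, hv⟩ | ⟨hΔ, x, hx, hx0, hv⟩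
  · exact exists_leadingLCoeff_eq_unit_mul_realPeriodRat_of_isLAlg_of_Δ_neg A hΔ hr hx hx0 hv
  · exact exists_leadingLCoeff_eq_unit_mul_realPeriodRat_of_isLAlg_of_Δ_pos A hΔ hr hx hx0 hv

end Summit.BirchSwinnertonDyer.Uniform.U2

end
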